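import Summits.QuantumAdvantage.AdviceFreeQNC0.JointRelativeElimination
import HarnessLib

/-!
# Cell qa-qnc0 (rung F-Q1, route RingFrame, crux α): joint elimination against the residues of ANY
# number of blocks (the induction engine of the interior-cluster special cases, general `t`)

For a list of block lengths `l = [L₀, …, L_t]` and `u : {0,1}^{Σ l}`, `blockWts l u` is the list of
block weights `[|u_{B₀}|, …, |u_{B_t}|]`.  A family of two-bit decoders (polynomials `a i, b i` and
tables `dec i`, `i < |l|`) NAMES ALL RESIDUES at `u` (`allNamed l a b dec u = true`) if
`dec i (a i u, b i u) ≡ |u_{B_i}| (mod 3)` for every block.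

* `multiElimHard_relative`: for every `t` and `γ > 0` there are `η, c > 0` and `M` such that for
  every `l` of length `t` with all blocks `≥ M`, every degree `d` with `d ≤ c√L` for all `L ∈ l`,
  every `v ∈ lowDeg d` with `#{v ≠ 0} ≥ γ·2^{Σ l}` and all decoders of degree `≤ d`:
  `#{u : v u ≠ 0, all residues named} ≥ η·2^{Σ l}`.  Induction on `t`: the step is the argument
  of `JointRelativeElimination.lean` with the induction hypothesis on the tail blocks in place of
  the second `elimHard_relative`.
* `multiElimHard`: the case `v = 1` — no polylog/`√`-degree device avoids naming its own residue
  cell of `t` long blocks, with a constant `η_t > 0` depending on `t` only.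

The cell's statements (prover); not in print.  The constants `η_t` decrease with `t` (iterates of
the constant of Srinivasan's lemma); nothing uniform in `t` is claimed.  WHAT THIS IS NOT: the
`t`-window ring theorem (a `3^{t+1}`-cell decoder feeding this engine) is not in this file;
nothing on `LDMAPolylog`, `TRPlus` or α in general; no separation.

## References

* S. Srinivasan, *A robust version of Hegedűs's lemma, with applications*, TheoretiCS 2 (2023),
  Lemma 3.1 [Srinivasan2023].
-/

noncomputable section

namespace Summit.QuantumAdvantage.AdviceFreeQNC0

open Finset
open Literature.Computability.MetaComplexity Literature.Computability.MetaComplexity.Smolensky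
open Literature.Computability.MetaComplexity.Hegedus

/-! ### Block weights and the "all residues named" predicate -/

/-- The list of block weights of `u : {0,1}^{L₀ + (L₁ + ⋯)}` for the block lengths `l`.
(Cell vocabulary.) -/
def blockWts : (l : List ℕ) → ((Fin l.sum → Bool) → List ℕ)
  | [], _ => []
  | (L :: rest), u => wt (fun i : Fin L => u (Fin.castAdd rest.sum i)) ::
      blockWts rest (fun j : Fin rest.sum => u (Fin.natAdd L j))

/-- `allNamed l a b dec u`: for every block `i < |l|` the decoder `dec i` applied to the two bits
`a i u, b i u` names the residue of the `i`-th block weight of `u` mod `3`. (Cell vocabulary.) -/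
def allNamed (l : List ℕ) (a b : ℕ → CubeFn (ZMod 2) l.sum) (dec : ℕ → ZMod 2 → ZMod 2 → ℕ)
    (u : Fin l.sum → Bool) : Bool :=
  (List.range l.length).all fun i => decide (dec i (a i u) (b i u) % 3 = (blockWts l u).getD i 0 % 3)

/-- Unfolding `allNamed` on a cons of blocks at an appended point. (Cell bookkeeping.) -/
theorem allNamed_cons (L : ℕ) (rest : List ℕ) (a b : ℕ → CubeFn (ZMod 2) (L :: rest).sum)
    (dec : ℕ → ZMod 2 → ZMod 2 → ℕ) (x : Fin L → Bool) (z : Fin rest.sum → Bool) :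
    allNamed (L :: rest) a b dec (Fin.append x z) =
      (decide (dec 0 (a 0 (Fin.append x z)) (b 0 (Fin.append x z)) % 3 = wt x % 3) &&
        allNamed rest (fun i => fun z' => a (i + 1) (Fin.append x z'))
          (fun i => fun z' => b (i + 1) (Fin.append x z')) (fun i => dec (i + 1)) z) := by
  unfold allNamed
  have hb : blockWts (L :: rest) (Fin.append x z) = wt x :: blockWts rest z := by
    show wt (fun i : Fin L => Fin.append x z (Fin.castAdd rest.sum i)) ::
      blockWts rest (fun j : Fin rest.sum => Fin.append x z (Fin.natAdd L j)) = _
    rw [left_of_append, right_of_append]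
  rw [List.length_cons, List.range_succ_eq_map, List.all_cons, List.all_map, hb]
  simp only [List.getD_cons_zero, Function.comp_def, Nat.succ_eq_add_one, List.getD_cons_succ]

/-! ### Multi-block joint elimination relative to a dense low-degree set -/

/-- **Multi-block joint elimination, relative form.**  For every number of blocks `t` and every
`γ > 0` there are `η, c > 0` and `M` such that for every list `l` of `t` block lengths all `≥ M`,
every `d` with `d ≤ c√L` for all `L ∈ l`, every `v ∈ lowDeg 𝔽₂ (Σ l) d` with
`#{v ≠ 0} ≥ γ·2^{Σ l}`, all decoder polynomials `a i, b i ∈ lowDeg d` and tables `dec i`: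
`#{u : v u ≠ 0 ∧ allNamed l a b dec u} ≥ η·2^{Σ l}`.  (Cell statement; induction on `t` with the
step of `jointElimHard_relative`.) [cite: Srinivasan2023, Lemma 3.1] -/
theorem multiElimHard_relative :
    ∀ (t : ℕ) (γ : ℝ), 0 < γ → ∃ η : ℝ, 0 < η ∧ ∃ c : ℝ, 0 < c ∧ ∃ M : ℕ, ∀ l : List ℕ,
      l.length = t → (∀ L ∈ l, M ≤ L) → ∀ d : ℕ, (∀ L ∈ l, (d : ℝ) ≤ c * Real.sqrt L) →
      ∀ (v : CubeFn (ZMod 2) l.sum) (a b : ℕ → CubeFn (ZMod 2) l.sum),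
        v ∈ lowDeg (ZMod 2) l.sum d → (∀ i, a i ∈ lowDeg (ZMod 2) l.sum d) →
        (∀ i, b i ∈ lowDeg (ZMod 2) l.sum d) → ∀ dec : ℕ → ZMod 2 → ZMod 2 → ℕ,
          γ * (2 : ℝ) ^ l.sum ≤ ((univ.filter fun u : Fin l.sum → Bool => v u ≠ 0).card : ℝ) →
          η * (2 : ℝ) ^ l.sum ≤ ((univ.filter fun u : Fin l.sum → Bool =>
            v u ≠ 0 ∧ allNamed l a b dec u = true).card : ℝ) := by
  intro t
  induction t with
  | zero =>
    intro γ hγ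
    refine ⟨γ, hγ, 1, one_pos, 0, fun l hl _ d _ v a b _ _ _ dec hdense => ?_⟩
    have hl0 : l = [] := List.length_eq_zero_iff.1 hl
    subst hl0
    refine hdense.trans (le_of_eq ?_)
    congr 2
    refine filter_congr fun u _ => ?_
    simp [allNamed]
  | succ t ih =>
    intro γ hγ
    classical
    obtain ⟨ηA, hηA, cA, hcA, nA, hA⟩ := elimHard_relative (γ / 2) (by positivity)
    set γ₁ := γ / 2 * ηA with hγ₁
    have hγ₁pos : 0 < γ₁ := by positivity
    obtain ⟨ηB, hηB, cB, hcB, MB, hB⟩ := ih (γ₁ / 10) (by positivity)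
    refine ⟨γ₁ / 2 * ηB, by positivity, min cA (cB / 3), lt_min hcA (by positivity), max nA MB, ?_⟩
    intro l hl hM d hd v a b hv ha hb dec hdense
    -- split `l = L :: rest`
    obtain ⟨L, rest, rfl⟩ : ∃ L rest, l = L :: rest := by
      cases l with
      | nil => simp at hl
      | cons L rest => exact ⟨L, rest, rfl⟩
    have hrest : rest.length = t := by simpa using hl
    -- retype the data over the cube `Fin (L + rest.sum) → Bool` (definitionally `(L :: rest).sum`)
    change CubeFn (ZMod 2) (L + rest.sum) at v
    change ℕ → CubeFn (ZMod 2) (L + rest.sum) at a b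
    change v ∈ lowDeg (ZMod 2) (L + rest.sum) d at hv
    change ∀ i, a i ∈ lowDeg (ZMod 2) (L + rest.sum) d at ha
    change ∀ i, b i ∈ lowDeg (ZMod 2) (L + rest.sum) d at hb
    have hLnA : nA ≤ L := le_trans (le_max_left _ _) (hM L (by simp))
    have hMB : ∀ L' ∈ rest, MB ≤ L' := fun L' hL' => le_trans (le_max_right _ _) (hM L' (by simp [hL']))
    have hdA : (d : ℝ) ≤ cA * Real.sqrt L :=
      (hd L (by simp)).trans (mul_le_mul_of_nonneg_right (min_le_left _ _) (Real.sqrt_nonneg _))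
    have hdB : ∀ L' ∈ rest, ((d + (d + d) : ℕ) : ℝ) ≤ cB * Real.sqrt L' := by
      intro L' hL'
      have h1 : (d : ℝ) ≤ cB / 3 * Real.sqrt L' :=
        (hd L' (by simp [hL'])).trans (mul_le_mul_of_nonneg_right (min_le_right _ _) (Real.sqrt_nonneg _))
      push_cast; linarith
    -- from here on the cube is `Fin (L + rest.sum) → Bool`
    change γ₁ / 2 * ηB * (2 : ℝ) ^ (L + rest.sum) ≤
      ((univ.filter fun u : Fin (L + rest.sum) → Bool =>
        v u ≠ 0 ∧ allNamed (L :: rest) a b dec u = true).card : ℝ)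
    change γ * (2 : ℝ) ^ (L + rest.sum) ≤
      ((univ.filter fun u : Fin (L + rest.sum) → Bool => v u ≠ 0).card : ℝ) at hdense
    -- events
    let EV : (Fin (L + rest.sum) → Bool) → Prop := fun w => v w ≠ 0
    let E₀ : (Fin (L + rest.sum) → Bool) → Prop := fun w =>
      dec 0 (a 0 w) (b 0 w) % 3 = wt (fun i : Fin L => w (Fin.castAdd rest.sum i)) % 3
    let ER : (Fin L → Bool) → (Fin rest.sum → Bool) → Prop := fun x z =>
      allNamed rest (fun i => fun z' => a (i + 1) (Fin.append x z'))
        (fun i => fun z' => b (i + 1) (Fin.append x z')) (fun i => dec (i + 1)) z = true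
    have hsplit : ∀ x z, (v (Fin.append x z) ≠ 0 ∧ allNamed (L :: rest) a b dec (Fin.append x z) = true) ↔
        (EV (Fin.append x z) ∧ E₀ (Fin.append x z) ∧ ER x z) := by
      intro x z
      rw [allNamed_cons, Bool.and_eq_true, decide_eq_true_iff]
      simp only [EV, E₀, ER, left_of_append]
      exact Iff.rfl
    -- (1) columns: relative elimination on the dense columns of `{v ≠ 0}`
    let Vc : (Fin rest.sum → Bool) → ℕ := fun z =>
      (univ.filter fun x : Fin L → Bool => EV (Fin.append x z)).card
    have hVc_le : ∀ z, (Vc z : ℝ) ≤ (2 : ℝ) ^ L := by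
      intro z
      have : Vc z ≤ (univ : Finset (Fin L → Bool)).card := card_le_card (filter_subset _ _)
      rw [card_univ, Fintype.card_fun, Fintype.card_bool, Fintype.card_fin] at this
      exact_mod_cast this
    have hcz : (Fintype.card (Fin rest.sum → Bool) : ℝ) = (2 : ℝ) ^ rest.sum := by
      rw [Fintype.card_fun, Fintype.card_bool, Fintype.card_fin]; push_cast; ring
    have hcx : (Fintype.card (Fin L → Bool) : ℝ) = (2 : ℝ) ^ L := by
      rw [Fintype.card_fun, Fintype.card_bool, Fintype.card_fin]; push_cast; ring
    have hVc_sum : γ * (Fintype.card (Fin rest.sum → Bool) : ℝ) * (2 : ℝ) ^ L ≤ ∑ z, (Vc z : ℝ) := by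
      have h := card_filter_eq_sum_right EV
      rw [hcz]
      calc γ * (2 : ℝ) ^ rest.sum * (2 : ℝ) ^ L = γ * (2 : ℝ) ^ (L + rest.sum) := by rw [pow_add]; ring
        _ ≤ ((univ.filter EV).card : ℝ) := hdense
        _ = ∑ z, (Vc z : ℝ) := by rw [h]; push_cast; rfl
    have hGz := card_filter_ge_of_sum_ge (fun z => (Vc z : ℝ)) ((2 : ℝ) ^ L) γ (by positivity)
      hVc_le hVc_sum
    rw [hcz] at hGz
    have hcol : ∀ z ∈ ((univ : Finset (Fin rest.sum → Bool)).filter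
        fun z => γ / 2 * (2 : ℝ) ^ L ≤ (Vc z : ℝ)), ηA * (2 : ℝ) ^ L ≤
        ((univ.filter fun x : Fin L → Bool => EV (Fin.append x z) ∧ E₀ (Fin.append x z)).card : ℝ) := by
      intro z hz
      rw [mem_filter] at hz
      have h := hA L hLnA d hdA (fun x => v (Fin.append x z)) (fun x => a 0 (Fin.append x z))
        (fun x => b 0 (Fin.append x z)) (comp_append_left_mem_lowDeg hv z)
        (comp_append_left_mem_lowDeg (ha 0) z) (comp_append_left_mem_lowDeg (hb 0) z) (dec 0) hz.2
      have hset : (univ.filter fun x : Fin L → Bool => v (Fin.append x z) ≠ 0 ∧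
          dec 0 (a 0 (Fin.append x z)) (b 0 (Fin.append x z)) % 3 = wt x % 3) =
          univ.filter fun x : Fin L → Bool => EV (Fin.append x z) ∧ E₀ (Fin.append x z) := by
        refine filter_congr fun x _ => ?_
        simp only [EV, E₀, left_of_append]
      rw [hset] at h
      exact h
    -- (2) rows: `A x = #{z : EV ∧ E₀}` sums to `≥ γ₁ 2^{L + rest.sum}`
    let A : (Fin L → Bool) → ℕ := fun x =>
      (univ.filter fun z : Fin rest.sum → Bool => EV (Fin.append x z) ∧ E₀ (Fin.append x z)).card
    have hA_sum : γ₁ * (Fintype.card (Fin L → Bool) : ℝ) * (2 : ℝ) ^ rest.sum ≤ ∑ x, (A x : ℝ) := by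
      have hswap : ((∑ x : Fin L → Bool, A x : ℕ) : ℝ) =
          ∑ z : Fin rest.sum → Bool, ((univ.filter fun x : Fin L → Bool =>
            EV (Fin.append x z) ∧ E₀ (Fin.append x z)).card : ℝ) := by
        have h1 := card_filter_eq_sum_left (fun w => EV w ∧ E₀ w)
        have h2 := card_filter_eq_sum_right (fun w => EV w ∧ E₀ w)
        have : (∑ x : Fin L → Bool, A x) = ∑ z : Fin rest.sum → Bool,
            (univ.filter fun x : Fin L → Bool => EV (Fin.append x z) ∧ E₀ (Fin.append x z)).card := by
          rw [← h1, h2]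
        exact_mod_cast this
      rw [hcx]
      push_cast at hswap ⊢
      rw [hswap]
      calc γ₁ * (2 : ℝ) ^ L * (2 : ℝ) ^ rest.sum = (γ / 2 * (2 : ℝ) ^ rest.sum) * (ηA * (2 : ℝ) ^ L) := by
            rw [hγ₁]; ring
        _ ≤ (((univ : Finset (Fin rest.sum → Bool)).filter
              fun z => γ / 2 * (2 : ℝ) ^ L ≤ (Vc z : ℝ)).card : ℝ) * (ηA * (2 : ℝ) ^ L) :=
            mul_le_mul_of_nonneg_right hGz (by positivity)
        _ = ∑ _z ∈ ((univ : Finset (Fin rest.sum → Bool)).filter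
              fun z => γ / 2 * (2 : ℝ) ^ L ≤ (Vc z : ℝ)), ηA * (2 : ℝ) ^ L := by
            rw [sum_const, nsmul_eq_mul]
        _ ≤ ∑ z ∈ ((univ : Finset (Fin rest.sum → Bool)).filter
              fun z => γ / 2 * (2 : ℝ) ^ L ≤ (Vc z : ℝ)), ((univ.filter fun x : Fin L → Bool =>
              EV (Fin.append x z) ∧ E₀ (Fin.append x z)).card : ℝ) := sum_le_sum hcol
        _ ≤ ∑ z, ((univ.filter fun x : Fin L → Bool =>
              EV (Fin.append x z) ∧ E₀ (Fin.append x z)).card : ℝ) :=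
            sum_le_sum_of_subset_of_nonneg (filter_subset _ _) fun _ _ _ => Nat.cast_nonneg _
    have hA_le : ∀ x, (A x : ℝ) ≤ (2 : ℝ) ^ rest.sum := by
      intro x
      have : A x ≤ (univ : Finset (Fin rest.sum → Bool)).card := card_le_card (filter_subset _ _)
      rw [card_univ, Fintype.card_fun, Fintype.card_bool, Fintype.card_fin] at this
      exact_mod_cast this
    have hGx := card_filter_ge_of_sum_ge (fun x => (A x : ℝ)) ((2 : ℝ) ^ rest.sum) γ₁ (by positivity)
      hA_le hA_sum
    rw [hcx] at hGx
    -- (3) good rows: dense level set, induction hypothesis on the tail blocks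
    have hrow : ∀ x ∈ ((univ : Finset (Fin L → Bool)).filter
        fun x => γ₁ / 2 * (2 : ℝ) ^ rest.sum ≤ (A x : ℝ)), ηB * (2 : ℝ) ^ rest.sum ≤
        ((univ.filter fun z : Fin rest.sum → Bool =>
          EV (Fin.append x z) ∧ E₀ (Fin.append x z) ∧ ER x z).card : ℝ) := by
      intro x hx
      rw [mem_filter] at hx
      have hAx := hx.2
      have hAeq : A x = ∑ p ∈ (univ : Finset (ZMod 2 × ZMod 2)).filter
          (fun p => dec 0 p.1 p.2 % 3 = wt x % 3),
          (univ.filter fun z : Fin rest.sum → Bool => v (Fin.append x z) ≠ 0 ∧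
            a 0 (Fin.append x z) = p.1 ∧ b 0 (Fin.append x z) = p.2).card := by
        have h := card_eq_sum_card_fiberwise
          (s := univ.filter fun z : Fin rest.sum → Bool => EV (Fin.append x z) ∧ E₀ (Fin.append x z))
          (t := (univ : Finset (ZMod 2 × ZMod 2)).filter fun p => dec 0 p.1 p.2 % 3 = wt x % 3)
          (f := fun z => (a 0 (Fin.append x z), b 0 (Fin.append x z))) (fun z hz => by
            rw [Finset.mem_coe, mem_filter] at hz
            rw [Finset.mem_coe, mem_filter]
            refine ⟨mem_univ _, ?_⟩
            have := hz.2.2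
            simp only [E₀, left_of_append] at this
            exact this)
        change (univ.filter fun z : Fin rest.sum → Bool =>
          EV (Fin.append x z) ∧ E₀ (Fin.append x z)).card = _
        rw [h]
        refine sum_congr rfl fun p hp => ?_
        rw [mem_filter] at hp
        congr 1
        ext z
        simp only [mem_filter, mem_univ, true_and, Prod.ext_iff, EV, E₀, left_of_append]
        constructor
        · rintro ⟨⟨hvz, -⟩, h1, h2⟩; exact ⟨hvz, h1, h2⟩
        · rintro ⟨hvz, h1, h2⟩; refine ⟨⟨hvz, ?_⟩, h1, h2⟩; rw [h1, h2]; exact hp.2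
      have hbig : ∃ p : ZMod 2 × ZMod 2, dec 0 p.1 p.2 % 3 = wt x % 3 ∧ γ₁ / 10 * (2 : ℝ) ^ rest.sum ≤
          ((univ.filter fun z : Fin rest.sum → Bool => v (Fin.append x z) ≠ 0 ∧
            a 0 (Fin.append x z) = p.1 ∧ b 0 (Fin.append x z) = p.2).card : ℝ) := by
        by_contra hno
        push Not at hno
        have hle : (A x : ℝ) ≤ ∑ _p ∈ (univ : Finset (ZMod 2 × ZMod 2)).filter
            (fun p => dec 0 p.1 p.2 % 3 = wt x % 3), γ₁ / 10 * (2 : ℝ) ^ rest.sum := by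
          rw [hAeq]; push_cast
          exact sum_le_sum fun p hp => le_of_lt (hno p (mem_filter.1 hp).2)
        rw [sum_const, nsmul_eq_mul] at hle
        have hc4 : (((univ : Finset (ZMod 2 × ZMod 2)).filter
            (fun p => dec 0 p.1 p.2 % 3 = wt x % 3)).card : ℝ) ≤ 4 := by
          have : ((univ : Finset (ZMod 2 × ZMod 2)).filter
              (fun p => dec 0 p.1 p.2 % 3 = wt x % 3)).card ≤
              (univ : Finset (ZMod 2 × ZMod 2)).card := card_le_card (filter_subset _ _)
          have h4 : (univ : Finset (ZMod 2 × ZMod 2)).card = 4 := by simp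
          rw [h4] at this; exact_mod_cast this
        have hmul : (((univ : Finset (ZMod 2 × ZMod 2)).filter
            (fun p => dec 0 p.1 p.2 % 3 = wt x % 3)).card : ℝ) * (γ₁ / 10 * (2 : ℝ) ^ rest.sum) ≤
              4 * (γ₁ / 10 * (2 : ℝ) ^ rest.sum) :=
          mul_le_mul_of_nonneg_right hc4 (by positivity)
        have hpos : (0 : ℝ) < γ₁ * (2 : ℝ) ^ rest.sum := by positivity
        linarith
      obtain ⟨⟨α, β⟩, hpr, hdenseL⟩ := hbig
      have hconst : ∀ c : ZMod 2, (fun _ : Fin rest.sum → Bool => c) ∈ lowDeg (ZMod 2) rest.sum d := by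
        intro c
        have h1 : (1 : CubeFn (ZMod 2) rest.sum) ∈ lowDeg (ZMod 2) rest.sum d := by
          rw [← mono_empty]; exact mono_mem_lowDeg (by simp)
        have : (fun _ : Fin rest.sum → Bool => c) = c • (1 : CubeFn (ZMod 2) rest.sum) := by
          funext u; simp
        rw [this]; exact Submodule.smul_mem _ c h1
      set vx : CubeFn (ZMod 2) rest.sum := (fun z => v (Fin.append x z)) *
        (((fun z => a 0 (Fin.append x z)) + (fun _ => α + 1)) *
          ((fun z => b 0 (Fin.append x z)) + (fun _ => β + 1))) with hvx
      have hvx_deg : vx ∈ lowDeg (ZMod 2) rest.sum (d + (d + d)) :=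
        mul_mem_lowDeg_add (comp_append_right_mem_lowDeg hv x)
          (mul_mem_lowDeg_add (Submodule.add_mem _ (comp_append_right_mem_lowDeg (ha 0) x) (hconst _))
            (Submodule.add_mem _ (comp_append_right_mem_lowDeg (hb 0) x) (hconst _)))
      have hvx_iff : ∀ z, vx z ≠ 0 ↔ v (Fin.append x z) ≠ 0 ∧
          a 0 (Fin.append x z) = α ∧ b 0 (Fin.append x z) = β := by
        intro z
        have key : ∀ s γ' : ZMod 2, s + (γ' + 1) ≠ 0 ↔ s = γ' := by decide
        simp only [hvx, Pi.mul_apply, Pi.add_apply, mul_ne_zero_iff]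
        rw [key, key]
      have hax : ∀ i, (fun z' => a (i + 1) (Fin.append x z')) ∈ lowDeg (ZMod 2) rest.sum (d + (d + d)) :=
        fun i => lowDeg_mono (by omega) (comp_append_right_mem_lowDeg (ha (i + 1)) x)
      have hbx : ∀ i, (fun z' => b (i + 1) (Fin.append x z')) ∈ lowDeg (ZMod 2) rest.sum (d + (d + d)) :=
        fun i => lowDeg_mono (by omega) (comp_append_right_mem_lowDeg (hb (i + 1)) x)
      have hsupp : (univ.filter fun z : Fin rest.sum → Bool => vx z ≠ 0) =
          univ.filter fun z : Fin rest.sum → Bool => v (Fin.append x z) ≠ 0 ∧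
            a 0 (Fin.append x z) = α ∧ b 0 (Fin.append x z) = β :=
        filter_congr fun z _ => hvx_iff z
      have hrel := hB rest hrest hMB (d + (d + d)) hdB vx
        (fun i => fun z' => a (i + 1) (Fin.append x z')) (fun i => fun z' => b (i + 1) (Fin.append x z'))
        hvx_deg hax hbx (fun i => dec (i + 1)) (by rw [hsupp]; exact hdenseL)
      refine hrel.trans ?_
      have hsub : (univ.filter fun z : Fin rest.sum → Bool => vx z ≠ 0 ∧
          allNamed rest (fun i => fun z' => a (i + 1) (Fin.append x z'))
            (fun i => fun z' => b (i + 1) (Fin.append x z')) (fun i => dec (i + 1)) z = true) ⊆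
          univ.filter fun z : Fin rest.sum → Bool =>
            EV (Fin.append x z) ∧ E₀ (Fin.append x z) ∧ ER x z := by
        intro z hz
        rw [mem_filter] at hz ⊢
        obtain ⟨hvz, hα, hβ⟩ := (hvx_iff z).1 hz.2.1
        refine ⟨mem_univ _, hvz, ?_, hz.2.2⟩
        simp only [E₀, left_of_append]
        have hpr' := hpr
        rw [← hα, ← hβ] at hpr'
        exact hpr'
      exact_mod_cast card_le_card hsub
    -- (4) sum over the good rows
    have htot : ((univ.filter fun u : Fin (L + rest.sum) → Bool =>
        v u ≠ 0 ∧ allNamed (L :: rest) a b dec u = true).card : ℝ) =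
        ∑ x : Fin L → Bool, ((univ.filter fun z : Fin rest.sum → Bool =>
          EV (Fin.append x z) ∧ E₀ (Fin.append x z) ∧ ER x z).card : ℝ) := by
      rw [card_filter_eq_sum_left (fun u : Fin (L + rest.sum) → Bool =>
        v u ≠ 0 ∧ allNamed (L :: rest) a b dec u = true)]
      push_cast
      refine sum_congr rfl fun x _ => ?_
      congr 1
      exact congrArg Finset.card (filter_congr fun z _ => hsplit x z)
    rw [htot]
    calc γ₁ / 2 * ηB * (2 : ℝ) ^ (L + rest.sum)
        = (γ₁ / 2 * (2 : ℝ) ^ L) * (ηB * (2 : ℝ) ^ rest.sum) := by rw [pow_add]; ring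
      _ ≤ (((univ : Finset (Fin L → Bool)).filter
            fun x => γ₁ / 2 * (2 : ℝ) ^ rest.sum ≤ (A x : ℝ)).card : ℝ) * (ηB * (2 : ℝ) ^ rest.sum) :=
          mul_le_mul_of_nonneg_right hGx (by positivity)
      _ = ∑ _x ∈ ((univ : Finset (Fin L → Bool)).filter
            fun x => γ₁ / 2 * (2 : ℝ) ^ rest.sum ≤ (A x : ℝ)), ηB * (2 : ℝ) ^ rest.sum := by
          rw [sum_const, nsmul_eq_mul]
      _ ≤ ∑ x ∈ ((univ : Finset (Fin L → Bool)).filter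
            fun x => γ₁ / 2 * (2 : ℝ) ^ rest.sum ≤ (A x : ℝ)),
            ((univ.filter fun z : Fin rest.sum → Bool =>
              EV (Fin.append x z) ∧ E₀ (Fin.append x z) ∧ ER x z).card : ℝ) := sum_le_sum hrow
      _ ≤ ∑ x : Fin L → Bool, ((univ.filter fun z : Fin rest.sum → Bool =>
            EV (Fin.append x z) ∧ E₀ (Fin.append x z) ∧ ER x z).card : ℝ) :=
          sum_le_sum_of_subset_of_nonneg (filter_subset _ _) fun _ _ _ => Nat.cast_nonneg _

/-- **Multi-block joint elimination** (the case `v = 1`): for every `t` there are `η_t, c > 0`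
and `M` such that for every `t` blocks all `≥ M`, every degree `d ≤ c√L` (all `L`), all decoders
of degree `≤ d` name ALL `t` block residues on at least `η_t·2^{Σ l}` inputs.
(Cell statement.) [cite: Srinivasan2023, Lemma 3.1] -/
theorem multiElimHard :
    ∀ t : ℕ, ∃ η : ℝ, 0 < η ∧ ∃ c : ℝ, 0 < c ∧ ∃ M : ℕ, ∀ l : List ℕ,
      l.length = t → (∀ L ∈ l, M ≤ L) → ∀ d : ℕ, (∀ L ∈ l, (d : ℝ) ≤ c * Real.sqrt L) →
      ∀ (a b : ℕ → CubeFn (ZMod 2) l.sum),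
        (∀ i, a i ∈ lowDeg (ZMod 2) l.sum d) → (∀ i, b i ∈ lowDeg (ZMod 2) l.sum d) →
        ∀ dec : ℕ → ZMod 2 → ZMod 2 → ℕ,
          η * (2 : ℝ) ^ l.sum ≤ ((univ.filter fun u : Fin l.sum → Bool =>
            allNamed l a b dec u = true).card : ℝ) := by
  intro t
  obtain ⟨η, hη, c, hc, M, h⟩ := multiElimHard_relative t 1 one_pos
  refine ⟨η, hη, c, hc, M, fun l hl hM d hd a b ha hb dec => ?_⟩
  classical
  have h1 : (1 : CubeFn (ZMod 2) l.sum) ∈ lowDeg (ZMod 2) l.sum d := by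
    rw [← mono_empty]; exact mono_mem_lowDeg (by simp)
  have hfull : (1 : ℝ) * (2 : ℝ) ^ l.sum ≤
      ((univ.filter fun u : Fin l.sum → Bool => (1 : CubeFn (ZMod 2) l.sum) u ≠ 0).card : ℝ) := by
    have : (univ.filter fun u : Fin l.sum → Bool => (1 : CubeFn (ZMod 2) l.sum) u ≠ 0) = univ :=
      filter_true_of_mem fun u _ => by simp
    rw [this, card_univ, Fintype.card_fun, Fintype.card_bool, Fintype.card_fin]
    push_cast; linarith
  refine (h l hl hM d hd 1 a b h1 ha hb dec hfull).trans (le_of_eq ?_)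
  congr 2
  refine filter_congr fun u _ => ?_
  simp

end Summit.QuantumAdvantage.AdviceFreeQNC0
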